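/-
Copyright (c) 2026 the pub-hodgecm-mathlib formalisation cell (harness21).  Prover seat hodgecm-mathlib-K2E5-p12 (g2), HCML Track B «K2-LIT», h413 =
`stmt-HodgeConjecture-24833`, line `K2_E3_EllipticInputs`, unit U3b, sub-line (ii♭-H) «RANK-ONE CAYLEY ROAD», letter (SC₂) — FILE 5 of 5: ‹Ψ-package›₂ OUTRIGHT on both
carriers.  2026-09-04.
-/
import Summits.HodgeConjecture.HodgeConjecture.Theorems.K2E3CayleyScalingLawRankOne     -- ★ FILE 4 (this seat): `scalingLaw_local_two : ‹SC₂-explicit›`; brings ★ p855890 `psiPackage_of_scalingLaw_local_two` ∕ `_two`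
import HarnessLib

/-!
# h413 ∕ K2-LIT, line `K2_E3_EllipticInputs`, unit U3b, (ii♭-H): THE RANK-ONE CAYLEY SCALING PACKAGE ‹Ψ-package›₂ HOLDS UNCONDITIONALLY (FILE 5)

Cell `pub/hodgecm-mathlib`, crux H413 = `stmt-HodgeConjecture-24833`, route of record `HCCMUnconditional`; chair K2-lead (g0), line lead (ii′) K2E4-p06 (g2), dealers
K2E3-plan ∕ K2E5-plan.  THEOREMS ONLY (no `def`, no `instance`, no `notation`, no named-fact hypothesis, no `sorry`); imports = ★ + HarnessLib; lane
`--supports stmt-HodgeConjecture-24833 --as helper` (count-neutral).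

`psiPackage_local_two` ∕ `psiPackage_two`: the CONCLUSIONS of ★ p855890 `psiPackage_of_scalingLaw_local_two` ∕ `psiPackage_of_scalingLaw_two` (K2E5-p12 (g0)) with their
hypothesis ‹SC₂-explicit› DISCHARGED by ★ FILE 4 `scalingLaw_local_two` — on `↥(«local» L c 2 Φ₂ v)` and on `(cmDatum L 2 Φ₂).Local v` (the spelling of U3b's sockets;
the carriers agree by ★ `cmDatum_Local` `rfl`): at every non-split `v` there is a pair `(Ψ, U₀)` with (U1) `U₀ ∈ 𝓝 1`, (U2) Ad-stable, (E) equivariant, (Z) `Z(Ψ γ) = Z(γ)`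
pointwise and as subgroups, (R) `IsRegularElt`-preserving, (C) `Ψ U₀ ⊆ U₀`, (T) `Ψ^k γ → 1`, (S) `1_{U₀}·(F∘Ψ) ∈ C_c^∞`, `1 < ‖q‖`, `a ≥ 1` off `[1]`, and (SC) the scaling law
of the unipotent orbital integrals.  So the input (Ψ-package♮) `sig_K2E3CentralUnipotentScalingPackage` of (HOM-ray*♮) (★ p855910) rests on the rank-one Cayley files
★ p855742 ∕ p855813 ∕ p855890 ∕ FILES 1–4 of (SC₂) and nothing else.

HONEST LABEL.  HC_CM is proved only modulo the 7 printed citations (2 remaining named inputs: hLiu418 = `stmt-HodgeConjecture-24832`, h413 =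
`stmt-HodgeConjecture-24833`) until rung 0 closes; count-neutral helper.

## References
* [Rogawski1990] J. D. Rogawski, *Automorphic Representations of Unitary Groups in Three Variables* (1990), §8.1 Prop. 8.1.2 (b) p. 114; (8.1.1) p. 116.
* [HarishChandra1999AdmissibleDistributions] Harish-Chandra, *Admissible Invariant Distributions on Reductive p-adic Groups*, ULS 16 (1999), §3.1 Lemma 3.2.
* [PlatonovRapinchuk1994] V. Platonov, A. Rapinchuk, *Algebraic Groups and Number Theory* (1994), §3.3, §5.1.
-/

set_option autoImplicit false
set_option linter.dupNamespace false  -- the mandated namespace repeats the single-problem summit's segment (`HodgeConjecture.HodgeConjecture`)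

noncomputable section

open NumberField IsDedekindDomain MeasureTheory Filter Topology Set
open scoped Matrix MatrixGroups
open Literature.NumberTheory.Rogawski1990 Literature.NumberTheory.Automorphic Literature.NumberTheory.Automorphic.UnitaryGroup
open Literature.NumberTheory.Weil1982.UnitaryFinTopForm
open Summit.HodgeConjecture.HodgeConjecture.Cruxes.H413.K2E3CayleyScalingRankOnePackage
open Summit.HodgeConjecture.HodgeConjecture.Cruxes.H413.K2E3CayleyScalingLawRankOne

namespace Summit.HodgeConjecture.HodgeConjecture.Cruxes.H413.K2E3CayleyScalingRankOnePackageHolds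

set_option maxHeartbeats 1600000 in
/-- **THE RANK-ONE CAYLEY SCALING PACKAGE ‹Ψ-package›₂ on `↥(«local» L c 2 Φ₂ v)`, UNCONDITIONAL** — ★ p855890 `psiPackage_of_scalingLaw_local_two` applied to
`scalingLaw_local_two`: at every non-split `v` there is an admissible pair `(Ψ, U₀)` with (U1)(U2)(E)(Z)(R)(C)(T)(S) and the scaling law (SC), exponents `a ≥ 1` off `[1]`,
`1 < ‖q‖`. [cite: Rogawski1990, §8.1 Prop. 8.1.2 (b) p. 114; (8.1.1) p. 116] [cite: HarishChandra1999AdmissibleDistributions, §3.1 Lemma 3.2] [cite: PlatonovRapinchuk1994, §3.3; §5.1] -/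
theorem psiPackage_local_two :
    ∀ (L : Type) [Field L] [NumberField L] [IsCMField L] (v : HeightOneSpectrum (𝓞 ↥(maximalRealSubfield L))),
      (∀ w : PlacesOver L v, IsCMField.complexConj L • w.1 = w.1) →
      ∀ [MeasurableSpace (↥(«local» L (IsCMField.complexConj L) 2 (Matrix.of fun i j : Fin 2 => if i.val + j.val + 1 = 2 then (1 : L) else 0) v))]
        [BorelSpace (↥(«local» L (IsCMField.complexConj L) 2 (Matrix.of fun i j : Fin 2 => if i.val + j.val + 1 = 2 then (1 : L) else 0) v))]
        [∀ γ : ↥(«local» L (IsCMField.complexConj L) 2 (Matrix.of fun i j : Fin 2 => if i.val + j.val + 1 = 2 then (1 : L) else 0) v),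
          MeasurableSpace (↥(«local» L (IsCMField.complexConj L) 2 (Matrix.of fun i j : Fin 2 => if i.val + j.val + 1 = 2 then (1 : L) else 0) v) ⧸
            Subgroup.centralizer ({γ} : Set (↥(«local» L (IsCMField.complexConj L) 2 (Matrix.of fun i j : Fin 2 => if i.val + j.val + 1 = 2 then (1 : L) else 0) v))))]
        [∀ γ : ↥(«local» L (IsCMField.complexConj L) 2 (Matrix.of fun i j : Fin 2 => if i.val + j.val + 1 = 2 then (1 : L) else 0) v),
          BorelSpace (↥(«local» L (IsCMField.complexConj L) 2 (Matrix.of fun i j : Fin 2 => if i.val + j.val + 1 = 2 then (1 : L) else 0) v) ⧸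
            Subgroup.centralizer ({γ} : Set (↥(«local» L (IsCMField.complexConj L) 2 (Matrix.of fun i j : Fin 2 => if i.val + j.val + 1 = 2 then (1 : L) else 0) v))))],
      ∃ (Ψ : ↥(«local» L (IsCMField.complexConj L) 2 (Matrix.of fun i j : Fin 2 => if i.val + j.val + 1 = 2 then (1 : L) else 0) v) →
            ↥(«local» L (IsCMField.complexConj L) 2 (Matrix.of fun i j : Fin 2 => if i.val + j.val + 1 = 2 then (1 : L) else 0) v))
        (U₀ : Set (↥(«local» L (IsCMField.complexConj L) 2 (Matrix.of fun i j : Fin 2 => if i.val + j.val + 1 = 2 then (1 : L) else 0) v))) (q : ℂ)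
        (a : ConjClasses (↥(«local» L (IsCMField.complexConj L) 2 (Matrix.of fun i j : Fin 2 => if i.val + j.val + 1 = 2 then (1 : L) else 0) v)) → ℕ),
        U₀ ∈ 𝓝 (1 : ↥(«local» L (IsCMField.complexConj L) 2 (Matrix.of fun i j : Fin 2 => if i.val + j.val + 1 = 2 then (1 : L) else 0) v)) ∧
        (∀ γ ∈ U₀, ∀ x : ↥(«local» L (IsCMField.complexConj L) 2 (Matrix.of fun i j : Fin 2 => if i.val + j.val + 1 = 2 then (1 : L) else 0) v), x * γ * x⁻¹ ∈ U₀) ∧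
        (∀ γ ∈ U₀, ∀ x : ↥(«local» L (IsCMField.complexConj L) 2 (Matrix.of fun i j : Fin 2 => if i.val + j.val + 1 = 2 then (1 : L) else 0) v), Ψ (x * γ * x⁻¹) = x * Ψ γ * x⁻¹) ∧
        (∀ γ ∈ U₀, (∀ z : ↥(«local» L (IsCMField.complexConj L) 2 (Matrix.of fun i j : Fin 2 => if i.val + j.val + 1 = 2 then (1 : L) else 0) v), z * γ = γ * z ↔ z * Ψ γ = Ψ γ * z) ∧
          Subgroup.centralizer ({Ψ γ} : Set (↥(«local» L (IsCMField.complexConj L) 2 (Matrix.of fun i j : Fin 2 => if i.val + j.val + 1 = 2 then (1 : L) else 0) v))) =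
            Subgroup.centralizer ({γ} : Set (↥(«local» L (IsCMField.complexConj L) 2 (Matrix.of fun i j : Fin 2 => if i.val + j.val + 1 = 2 then (1 : L) else 0) v)))) ∧
        (∀ γ ∈ U₀, IsRegularElt (γ : GL (Fin 2) (UnitaryGroup.LocalRing L v)) →
          IsRegularElt ((Ψ γ : ↥(«local» L (IsCMField.complexConj L) 2 (Matrix.of fun i j : Fin 2 => if i.val + j.val + 1 = 2 then (1 : L) else 0) v)) : GL (Fin 2) (UnitaryGroup.LocalRing L v))) ∧
        (∀ γ ∈ U₀, Ψ γ ∈ U₀) ∧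
        (∀ γ ∈ U₀, Tendsto (fun k : ℕ => Ψ^[k] γ) atTop (𝓝 (1 : ↥(«local» L (IsCMField.complexConj L) 2 (Matrix.of fun i j : Fin 2 => if i.val + j.val + 1 = 2 then (1 : L) else 0) v)))) ∧
        (∀ F : ↥(«local» L (IsCMField.complexConj L) 2 (Matrix.of fun i j : Fin 2 => if i.val + j.val + 1 = 2 then (1 : L) else 0) v) → ℂ, IsLocSmooth F → IsLocSmooth (U₀.indicator (F ∘ Ψ))) ∧
        1 < ‖q‖ ∧
        (∀ u : ConjClasses (↥(«local» L (IsCMField.complexConj L) 2 (Matrix.of fun i j : Fin 2 => if i.val + j.val + 1 = 2 then (1 : L) else 0) v)), u ≠ ConjClasses.mk 1 → 1 ≤ a u) ∧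
        ∀ (S : Finset (ConjClasses (↥(«local» L (IsCMField.complexConj L) 2 (Matrix.of fun i j : Fin 2 => if i.val + j.val + 1 = 2 then (1 : L) else 0) v))))
          (mU : OrbitalMeasureFamily (↥(«local» L (IsCMField.complexConj L) 2 (Matrix.of fun i j : Fin 2 => if i.val + j.val + 1 = 2 then (1 : L) else 0) v))),
          (∀ u ∈ S, (((Quotient.out u : ↥(«local» L (IsCMField.complexConj L) 2 (Matrix.of fun i j : Fin 2 => if i.val + j.val + 1 = 2 then (1 : L) else 0) v)).val :
              GL (Fin 2) (UnitaryGroup.LocalRing L v)).val - 1) ^ 2 = 0) →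
          mU.IsAdmissibleOn (fun γ : ↥(«local» L (IsCMField.complexConj L) 2 (Matrix.of fun i j : Fin 2 => if i.val + j.val + 1 = 2 then (1 : L) else 0) v) => (ConjClasses.mk γ) ∈ S) →
          ∀ u ∈ S, ∀ F : ↥(«local» L (IsCMField.complexConj L) 2 (Matrix.of fun i j : Fin 2 => if i.val + j.val + 1 = 2 then (1 : L) else 0) v) → ℂ, IsLocSmooth F →
            classOrbitalIntegral mU (U₀.indicator (F ∘ Ψ)) u = q ^ (a u) * classOrbitalIntegral mU F u :=
  psiPackage_of_scalingLaw_local_two scalingLaw_local_two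

set_option maxHeartbeats 1600000 in
/-- **THE RANK-ONE CAYLEY SCALING PACKAGE ‹Ψ-package›₂ on `(cmDatum L 2 Φ₂).Local v`, UNCONDITIONAL** (the spelling of U3b's sockets; ★ p855890 `psiPackage_of_scalingLaw_two`
applied to `scalingLaw_local_two`, the carriers agree by ★ `cmDatum_Local` `rfl`). [cite: Rogawski1990, §8.1 Prop. 8.1.2 (b) p. 114; (8.1.1) p. 116]
[cite: HarishChandra1999AdmissibleDistributions, §3.1 Lemma 3.2] [cite: PlatonovRapinchuk1994, §3.3; §5.1] -/
theorem psiPackage_two :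
    ∀ (L : Type) [Field L] [NumberField L] [IsCMField L] (v : HeightOneSpectrum (𝓞 ↥(maximalRealSubfield L))),
      (∀ w : PlacesOver L v, IsCMField.complexConj L • w.1 = w.1) →
      ∀ [MeasurableSpace ((UnitaryGroup.cmDatum L 2 (Matrix.of fun i j : Fin 2 => if i.val + j.val + 1 = 2 then (1 : L) else 0)).Local v)]
        [BorelSpace ((UnitaryGroup.cmDatum L 2 (Matrix.of fun i j : Fin 2 => if i.val + j.val + 1 = 2 then (1 : L) else 0)).Local v)]
        [∀ γ : (UnitaryGroup.cmDatum L 2 (Matrix.of fun i j : Fin 2 => if i.val + j.val + 1 = 2 then (1 : L) else 0)).Local v,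
          MeasurableSpace ((UnitaryGroup.cmDatum L 2 (Matrix.of fun i j : Fin 2 => if i.val + j.val + 1 = 2 then (1 : L) else 0)).Local v ⧸
            Subgroup.centralizer ({γ} : Set ((UnitaryGroup.cmDatum L 2 (Matrix.of fun i j : Fin 2 => if i.val + j.val + 1 = 2 then (1 : L) else 0)).Local v)))]
        [∀ γ : (UnitaryGroup.cmDatum L 2 (Matrix.of fun i j : Fin 2 => if i.val + j.val + 1 = 2 then (1 : L) else 0)).Local v,
          BorelSpace ((UnitaryGroup.cmDatum L 2 (Matrix.of fun i j : Fin 2 => if i.val + j.val + 1 = 2 then (1 : L) else 0)).Local v ⧸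
            Subgroup.centralizer ({γ} : Set ((UnitaryGroup.cmDatum L 2 (Matrix.of fun i j : Fin 2 => if i.val + j.val + 1 = 2 then (1 : L) else 0)).Local v)))],
      ∃ (Ψ : (UnitaryGroup.cmDatum L 2 (Matrix.of fun i j : Fin 2 => if i.val + j.val + 1 = 2 then (1 : L) else 0)).Local v →
            (UnitaryGroup.cmDatum L 2 (Matrix.of fun i j : Fin 2 => if i.val + j.val + 1 = 2 then (1 : L) else 0)).Local v)
        (U₀ : Set ((UnitaryGroup.cmDatum L 2 (Matrix.of fun i j : Fin 2 => if i.val + j.val + 1 = 2 then (1 : L) else 0)).Local v)) (q : ℂ)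
        (a : ConjClasses ((UnitaryGroup.cmDatum L 2 (Matrix.of fun i j : Fin 2 => if i.val + j.val + 1 = 2 then (1 : L) else 0)).Local v) → ℕ),
        U₀ ∈ 𝓝 (1 : (UnitaryGroup.cmDatum L 2 (Matrix.of fun i j : Fin 2 => if i.val + j.val + 1 = 2 then (1 : L) else 0)).Local v) ∧
        (∀ γ ∈ U₀, ∀ x : (UnitaryGroup.cmDatum L 2 (Matrix.of fun i j : Fin 2 => if i.val + j.val + 1 = 2 then (1 : L) else 0)).Local v, x * γ * x⁻¹ ∈ U₀) ∧
        (∀ γ ∈ U₀, ∀ x : (UnitaryGroup.cmDatum L 2 (Matrix.of fun i j : Fin 2 => if i.val + j.val + 1 = 2 then (1 : L) else 0)).Local v, Ψ (x * γ * x⁻¹) = x * Ψ γ * x⁻¹) ∧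
        (∀ γ ∈ U₀, (∀ z : (UnitaryGroup.cmDatum L 2 (Matrix.of fun i j : Fin 2 => if i.val + j.val + 1 = 2 then (1 : L) else 0)).Local v, z * γ = γ * z ↔ z * Ψ γ = Ψ γ * z) ∧
          Subgroup.centralizer ({Ψ γ} : Set ((UnitaryGroup.cmDatum L 2 (Matrix.of fun i j : Fin 2 => if i.val + j.val + 1 = 2 then (1 : L) else 0)).Local v)) =
            Subgroup.centralizer ({γ} : Set ((UnitaryGroup.cmDatum L 2 (Matrix.of fun i j : Fin 2 => if i.val + j.val + 1 = 2 then (1 : L) else 0)).Local v))) ∧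
        (∀ γ ∈ U₀, IsRegularElt (γ.val : GL (Fin 2) (UnitaryGroup.LocalRing L v)) →
          IsRegularElt ((Ψ γ).val : GL (Fin 2) (UnitaryGroup.LocalRing L v))) ∧
        (∀ γ ∈ U₀, Ψ γ ∈ U₀) ∧
        (∀ γ ∈ U₀, Tendsto (fun k : ℕ => Ψ^[k] γ) atTop (𝓝 (1 : (UnitaryGroup.cmDatum L 2 (Matrix.of fun i j : Fin 2 => if i.val + j.val + 1 = 2 then (1 : L) else 0)).Local v))) ∧
        (∀ F : (UnitaryGroup.cmDatum L 2 (Matrix.of fun i j : Fin 2 => if i.val + j.val + 1 = 2 then (1 : L) else 0)).Local v → ℂ, IsLocSmooth F → IsLocSmooth (U₀.indicator (F ∘ Ψ))) ∧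
        1 < ‖q‖ ∧
        (∀ u : ConjClasses ((UnitaryGroup.cmDatum L 2 (Matrix.of fun i j : Fin 2 => if i.val + j.val + 1 = 2 then (1 : L) else 0)).Local v), u ≠ ConjClasses.mk 1 → 1 ≤ a u) ∧
        ∀ (S : Finset (ConjClasses ((UnitaryGroup.cmDatum L 2 (Matrix.of fun i j : Fin 2 => if i.val + j.val + 1 = 2 then (1 : L) else 0)).Local v)))
          (mU : OrbitalMeasureFamily ((UnitaryGroup.cmDatum L 2 (Matrix.of fun i j : Fin 2 => if i.val + j.val + 1 = 2 then (1 : L) else 0)).Local v)),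
          (∀ u ∈ S, (((Quotient.out u : (UnitaryGroup.cmDatum L 2 (Matrix.of fun i j : Fin 2 => if i.val + j.val + 1 = 2 then (1 : L) else 0)).Local v).val :
              GL (Fin 2) (UnitaryGroup.LocalRing L v)).val - 1) ^ 2 = 0) →
          mU.IsAdmissibleOn (fun γ : (UnitaryGroup.cmDatum L 2 (Matrix.of fun i j : Fin 2 => if i.val + j.val + 1 = 2 then (1 : L) else 0)).Local v => (ConjClasses.mk γ) ∈ S) →
          ∀ u ∈ S, ∀ F : (UnitaryGroup.cmDatum L 2 (Matrix.of fun i j : Fin 2 => if i.val + j.val + 1 = 2 then (1 : L) else 0)).Local v → ℂ, IsLocSmooth F →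
            classOrbitalIntegral mU (U₀.indicator (F ∘ Ψ)) u = q ^ (a u) * classOrbitalIntegral mU F u :=
  psiPackage_of_scalingLaw_two scalingLaw_local_two

end Summit.HodgeConjecture.HodgeConjecture.Cruxes.H413.K2E3CayleyScalingRankOnePackageHolds

end
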